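import Summits.AnomalousDissipation.AnomalousDissipation.Theorems.SolenoidalFractalHomogenisationLagrangianStepVmodShortCore
import Summits.AnomalousDissipation.AnomalousDissipation.Theorems.SolenoidalFractalHomogenisationLagrangianStepVmodTransportDualityAdjoint
import Summits.AnomalousDissipation.AnomalousDissipation.Theorems.SolenoidalFractalHomogenisationLagrangianStepVmodTensorChange
import Summits.AnomalousDissipation.AnomalousDissipation.Theorems.SolenoidalFractalHomogenisationLagrangianStepCellCorrectorContent
import Summits.AnomalousDissipation.AnomalousDissipation.Theorems.SolenoidalFractalHomogenisationLagrangianStepZ7GlueDefsR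
import HarnessLib

/-!
# K1L_D (stmt-AnomalousDissipation-27980): (V_mod) flat stage — the SHORT-WINDOW ROW of the flat blocks with a fast side:
# `|⟪U x − T x, ζ⟫| ≤ C_s·√q_T(x)·√q*_T(ζ)` for `t − s ≤ M·W.period/ν`, `x` or `ζ` fast, `C_s` free of `ν, n, 𝔸, s, t`
(line file of the (V_mod) lane, short-window engine F4c-3 of the (ff) block (and of (fs)/(sf)); prover ad-k3l-bookkeeping-p1 g9, resubmitted by g10
after a dedup bounce — the squares lemma is Mathlib's `pow_left_inj₀`.)

Instantiation of `short_window_core` (F4c-2) on the objects of `VmodFlat.BlockBound`: cell member `U` (carrier `cellField W M hM ν _ n`,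
`‖·‖ ≤ k/(2πn)`, tensor `(1/n²)•𝔸`), coarse member `T` (no drift, tensor `(1/n²)•(𝔸 + (c/ν)•Φ ν (𝔸/ν))`), with the three analytic inputs
`abs_inner_sub_inner_driftFree_le` (F4a, `A = 3B(t−s)`), `abs_inner_sub_inner_driftFree_le_adjoint` (F4a′), `abs_inner_sub_inner_tensorChange_le`
(F4b, `D = 4π²(K₁+K₂)(t−s)`), the lower ellipticity constant `lo⋆ = (c/ν)(lo/Λ)/n²` of the coarse tensor and the split level `N = ⌊(8π²lo⋆(t−s))^{-1/2}⌋`.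
In clause units the core's constant is at most **`C_s = 2kΛ/(c·lo) + 2k·√(M·W.period·Λ/(c·lo)) + (2/c + 1)·Λ·(hi·Λ + β/2)/lo + 16`** for every window
`t − s ≤ M·W.period/ν` — free of `ν, n, 𝔸, s, t` (**`short_pairing_le_of_fast`**).  This is the row «τ ≤ P» of (ff), (fs) and (sf) at once (the
allowance factor `min 1 (P/(t−s))` of `BlockBound` is `1` there), with NO (V)/W7 input.  `sorry`-free; NOT a proof of any block, of the stub, of
K1L_D or AD; rung F-D1.A0.
-/

set_option linter.dupNamespace false

noncomputable section

namespace Summit.AnomalousDissipation.AnomalousDissipation.Theorems.SolenoidalFractalHomogenisation.LagrangianStep.VmodFlat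

open Literature.Analysis Literature.Analysis.FluidPDE Literature.Analysis.FunctionSpaces
open MeasureTheory Set Filter UnitAddTorus
open scoped ENNReal NNReal InnerProductSpace
open Summit.AnomalousDissipation.AnomalousDissipation.Theorems.SolenoidalFractalHomogenisation.LagrangianStep.CellClauseMod
open Summit.AnomalousDissipation.AnomalousDissipation.Theorems.SolenoidalFractalHomogenisation.RealisedQuasiStaticCellLaw
  (isSmooth_cell isDivFree_cell memLp_top_stLift_cell)

/-! ## §1 Arithmetic -/

/-- `n/16 ≤ √((n/4)² + 1)` (integer division). [folklore] -/
theorem div_sixteen_le_sqrt_m (n : ℕ) : (n : ℝ) / 16 ≤ Real.sqrt ((((n / 4 : ℕ) : ℝ)) ^ 2 + 1) := by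
  have h1 : (1:ℝ) ≤ Real.sqrt ((((n / 4 : ℕ) : ℝ)) ^ 2 + 1) := by
    rw [show (1:ℝ) = Real.sqrt 1 by simp]
    exact Real.sqrt_le_sqrt (by nlinarith [sq_nonneg (((n / 4 : ℕ) : ℝ))])
  have h2 : (((n / 4 : ℕ) : ℝ)) ≤ Real.sqrt ((((n / 4 : ℕ) : ℝ)) ^ 2 + 1) := by
    calc (((n / 4 : ℕ) : ℝ)) = Real.sqrt ((((n / 4 : ℕ) : ℝ)) ^ 2) := (Real.sqrt_sq (Nat.cast_nonneg _)).symm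
      _ ≤ _ := Real.sqrt_le_sqrt (by linarith)
  have h3 : (n : ℝ) ≤ 4 * (((n / 4 : ℕ) : ℝ)) + 3 := by
    have h := Nat.div_add_mod n 4
    have hm : n % 4 < 4 := Nat.mod_lt _ (by norm_num)
    have : (n : ℝ) = 4 * (((n / 4 : ℕ) : ℝ)) + ((n % 4 : ℕ) : ℝ) := by exact_mod_cast h.symm
    have hm' : ((n % 4 : ℕ) : ℝ) ≤ 3 := by exact_mod_cast Nat.lt_succ_iff.1 hm
    linarith
  rcases le_or_gt (n : ℝ) 16 with hn | hn
  · linarith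
  · linarith

/-- **Term 1 of the core's constant in clause units**: `4πA/(κτ√m) ≤ 2kΛ/(c·lo)` (`A = 3Bτ`, `B = k/(2πn)`, `κτ = 8π²lo⋆τ`,
`lo⋆ = (c/ν)(lo/Λ)/n²`, `√m ≥ n/16`, `ν ≤ 1`). [folklore] -/
theorem shortConst_term1_le (k n : ℕ) (hn : 0 < n) {c lo Λ ν τ m : ℝ} (hc : 0 < c) (hlo : 0 < lo) (hΛ : 0 < Λ) (hν : 0 < ν) (hν1 : ν ≤ 1)
    (hτ : 0 < τ) (hm0 : 0 < m) (hm : (n : ℝ) / 16 ≤ Real.sqrt m) :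
    4 * Real.pi * (3 * ((k : ℝ) / (2 * Real.pi * n)) * τ) / (8 * Real.pi ^ 2 * (1 / (n:ℝ) ^ 2 * (c / ν * (lo / Λ))) * τ * Real.sqrt m)
      ≤ 2 * k * Λ / (c * lo) := by
  have hn' : (0:ℝ) < n := by exact_mod_cast hn
  have hπ0 : (0:ℝ) < Real.pi := Real.pi_pos
  have hπ3 : (3:ℝ) < Real.pi := Real.pi_gt_three
  have hsm0 : 0 < Real.sqrt m := Real.sqrt_pos.2 hm0
  have e1 : 4 * Real.pi * (3 * ((k : ℝ) / (2 * Real.pi * n)) * τ) / (8 * Real.pi ^ 2 * (1 / (n:ℝ) ^ 2 * (c / ν * (lo / Λ))) * τ * Real.sqrt m)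
      = 3 * k * Λ * ν * n / (4 * Real.pi ^ 2 * c * lo * Real.sqrt m) := by
    field_simp
    ring
  rw [e1]
  have h2 : 3 * (k:ℝ) * Λ * ν * n / (4 * Real.pi ^ 2 * c * lo * Real.sqrt m) ≤ 3 * k * Λ * ν * n / (4 * Real.pi ^ 2 * c * lo * ((n:ℝ) / 16)) :=
    div_le_div_of_nonneg_left (by positivity) (by positivity) (mul_le_mul_of_nonneg_left hm (by positivity))
  refine h2.trans ?_
  have e2 : 3 * (k:ℝ) * Λ * ν * n / (4 * Real.pi ^ 2 * c * lo * ((n:ℝ) / 16)) = 12 * k * Λ * ν / (Real.pi ^ 2 * c * lo) := by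
    field_simp
    ring
  rw [e2, div_le_div_iff₀ (by positivity) (by positivity)]
  have h9 : (9:ℝ) ≤ Real.pi ^ 2 := by nlinarith
  have hk0 : (0:ℝ) ≤ k := Nat.cast_nonneg k
  have h4 : (0:ℝ) ≤ k * Λ * (c * lo) := by positivity
  have h5 : 12 * (k:ℝ) * Λ * ν * (c * lo) ≤ 12 * k * Λ * (c * lo) := by nlinarith [mul_nonneg h4 hν.le]
  nlinarith [mul_le_mul_of_nonneg_left h9 h4]

/-- **Term 2**: `8√2πA/√κτ ≤ 2k√(P₀Λ/(c·lo))` when `τ ≤ P₀/ν`. [folklore] -/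
theorem shortConst_term2_le (k n : ℕ) (hn : 0 < n) {c lo Λ ν τ P₀ : ℝ} (hc : 0 < c) (hlo : 0 < lo) (hΛ : 0 < Λ) (hν : 0 < ν)
    (hτ : 0 < τ) (hP : τ ≤ P₀ / ν) :
    8 * Real.sqrt 2 * Real.pi * (3 * ((k : ℝ) / (2 * Real.pi * n)) * τ) / Real.sqrt (8 * Real.pi ^ 2 * (1 / (n:ℝ) ^ 2 * (c / ν * (lo / Λ))) * τ)
      ≤ 2 * k * Real.sqrt (P₀ * Λ / (c * lo)) := by
  have hn' : (0:ℝ) < n := by exact_mod_cast hn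
  have hπ0 : (0:ℝ) < Real.pi := Real.pi_pos
  have hπ3 : (3:ℝ) < Real.pi := Real.pi_gt_three
  have hk0 : (0:ℝ) ≤ k := Nat.cast_nonneg k
  have hκ0 : 0 < 8 * Real.pi ^ 2 * (1 / (n:ℝ) ^ 2 * (c / ν * (lo / Λ))) * τ := by positivity
  set X : ℝ := τ * Λ * ν / (c * lo) with hXdef
  have hX0 : 0 ≤ X := by rw [hXdef]; positivity
  have hlhs0 : 0 ≤ 8 * Real.sqrt 2 * Real.pi * (3 * ((k : ℝ) / (2 * Real.pi * n)) * τ) /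
      Real.sqrt (8 * Real.pi ^ 2 * (1 / (n:ℝ) ^ 2 * (c / ν * (lo / Λ))) * τ) := by positivity
  have hsq : (8 * Real.sqrt 2 * Real.pi * (3 * ((k : ℝ) / (2 * Real.pi * n)) * τ) /
      Real.sqrt (8 * Real.pi ^ 2 * (1 / (n:ℝ) ^ 2 * (c / ν * (lo / Λ))) * τ)) ^ 2 = (6 * k / Real.pi * Real.sqrt X) ^ 2 := by
    rw [div_pow, mul_pow (6 * (k:ℝ) / Real.pi), Real.sq_sqrt hκ0.le, Real.sq_sqrt hX0,
      show (8 * Real.sqrt 2 * Real.pi * (3 * ((k : ℝ) / (2 * Real.pi * n)) * τ)) ^ 2 =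
        64 * (Real.sqrt 2) ^ 2 * Real.pi ^ 2 * (3 * ((k : ℝ) / (2 * Real.pi * n)) * τ) ^ 2 by ring,
      Real.sq_sqrt (by norm_num : (0:ℝ) ≤ 2), hXdef]
    field_simp
    ring
  have heq := (pow_left_inj₀ hlhs0 (by positivity : (0:ℝ) ≤ 6 * k / Real.pi * Real.sqrt X) two_ne_zero).1 hsq
  rw [heq]
  have hX1 : X ≤ P₀ * Λ / (c * lo) := by
    rw [hXdef]
    refine div_le_div_of_nonneg_right ?_ (by positivity)
    have h1 : τ * ν ≤ P₀ := by
      have := (le_div_iff₀ hν).1 hP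
      linarith
    nlinarith [h1, hΛ]
  have h6 : 6 * (k:ℝ) / Real.pi ≤ 2 * k := by
    rw [div_le_iff₀ hπ0]; nlinarith
  exact mul_le_mul h6 (Real.sqrt_le_sqrt hX1) (Real.sqrt_nonneg _) (by positivity)

/-- **Term 3**: `2D/κτ ≤ (2/c + 1)Λ(hiΛ + β/2)/lo` (`D = 4π²(K₁+K₂)τ`, the `Kᵢ` of the two cell tensors, `λ, λ' ∈ [1, Λ]`, `ν ≤ 1`). [folklore] -/
theorem shortConst_term3_le (n : ℕ) (hn : 0 < n) {c lo hi Λ β ν τ lam₁ lam₂ : ℝ} (hc : 0 < c) (hlo : 0 < lo) (hhi : 0 ≤ hi) (hβ : 0 ≤ β)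
    (hν : 0 < ν) (hν1 : ν ≤ 1) (hτ : 0 < τ) (hlam₁ : 1 ≤ lam₁) (hlam₁Λ : lam₁ ≤ Λ) (hlam₂Λ : lam₂ ≤ Λ) :
    2 * (4 * Real.pi ^ 2 * (1 / (n:ℝ) ^ 2 * (ν * (hi * lam₁)) + 1 / (n:ℝ) ^ 2 * (ν * β) / 2 +
        (1 / (n:ℝ) ^ 2 * (ν * (hi * lam₁) + c / ν * (hi * lam₂)) + 1 / (n:ℝ) ^ 2 * (ν * β + c / ν * β) / 2)) * τ) /
      (8 * Real.pi ^ 2 * (1 / (n:ℝ) ^ 2 * (c / ν * (lo / Λ))) * τ)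
      ≤ (2 / c + 1) * Λ * (hi * Λ + β / 2) / lo := by
  have hn' : (0:ℝ) < n := by exact_mod_cast hn
  have hπ0 : (0:ℝ) < Real.pi := Real.pi_pos
  have hΛ0 : 0 < Λ := by linarith
  have hcν : 0 ≤ c / ν := by positivity
  have e1 : 2 * (4 * Real.pi ^ 2 * (1 / (n:ℝ) ^ 2 * (ν * (hi * lam₁)) + 1 / (n:ℝ) ^ 2 * (ν * β) / 2 +
        (1 / (n:ℝ) ^ 2 * (ν * (hi * lam₁) + c / ν * (hi * lam₂)) + 1 / (n:ℝ) ^ 2 * (ν * β + c / ν * β) / 2)) * τ) /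
      (8 * Real.pi ^ 2 * (1 / (n:ℝ) ^ 2 * (c / ν * (lo / Λ))) * τ)
      = (ν * (hi * lam₁) + ν * β / 2 + (ν * (hi * lam₁) + c / ν * (hi * lam₂)) + (ν * β + c / ν * β) / 2) / (c / ν * (lo / Λ)) := by
    field_simp
    ring
  rw [e1]
  have h1 : hi * lam₁ ≤ hi * Λ := mul_le_mul_of_nonneg_left hlam₁Λ hhi
  have h2 : hi * lam₂ ≤ hi * Λ := mul_le_mul_of_nonneg_left hlam₂Λ hhi
  have h3 : ν * (hi * lam₁) ≤ ν * (hi * Λ) := mul_le_mul_of_nonneg_left h1 hν.le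
  have h4 : c / ν * (hi * lam₂) ≤ c / ν * (hi * Λ) := mul_le_mul_of_nonneg_left h2 hcν
  have hnum : ν * (hi * lam₁) + ν * β / 2 + (ν * (hi * lam₁) + c / ν * (hi * lam₂)) + (ν * β + c / ν * β) / 2
      ≤ (2 * ν + c / ν) * (hi * Λ + β / 2) := by nlinarith [h3, h4]
  have hden : 0 < c / ν * (lo / Λ) := by positivity
  refine (div_le_div_of_nonneg_right hnum hden.le).trans ?_
  have e2 : (2 * ν + c / ν) * (hi * Λ + β / 2) / (c / ν * (lo / Λ)) = (2 * ν ^ 2 / c + 1) * Λ * (hi * Λ + β / 2) / lo := by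
    field_simp
  rw [e2]
  refine div_le_div_of_nonneg_right ?_ hlo.le
  have hν2 : ν ^ 2 ≤ 1 := by nlinarith
  have h7 : 2 * ν ^ 2 / c ≤ 2 / c := div_le_div_of_nonneg_right (by linarith) hc.le
  have h8 : 0 ≤ Λ * (hi * Λ + β / 2) := by positivity
  nlinarith [h7, h8]

/-! ## §2 The short-window row -/

set_option maxHeartbeats 1600000 in
/-- **THE SHORT-WINDOW ROW WITH A FAST SIDE.**  In the regime of `VmodFlat.BlockBound` (`0 < ν ≤ 1`, `n ≥ 1`, `𝔸` with `OddSmall 𝔸 (νβ)` and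
`NearIso 𝔸 (ν·lo/λ) (ν·hi·λ)`, `Φ ν (𝔸/ν)` with `OddSmall _ β` and `NearIso _ (lo/λ') (hi·λ')`, `λ, λ' ∈ [1, Λ]`; cell member `U`, coarse member `T`
on `[0, Tw]`), for every window `0 ≤ s < t ≤ Tw` with `t − s ≤ M·W.period/ν` and all `x, ζ ∈ V2` one of which is fast at resolution `n`:
`|⟪U s t x − T s t x, ζ⟫| ≤ C_s·√(lossFwd (T s t) x)·√(lossAdj (T s t) ζ)`, `C_s = 2kΛ/(c·lo) + 2k√(M·W.period·Λ/(c·lo)) + (2/c+1)Λ(hiΛ + β/2)/lo + 16`. -/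
theorem short_pairing_le_of_fast {k : ℕ} (W : LatticeShear.LatticeWord k) (M : ℝ) (hM : 0 < M) {c : ℝ} (hc : 0 < c)
    (Φ : ℝ → Torus.Visc4 (Fin 3) → Torus.Visc4 (Fin 3)) {lo hi Λ β : ℝ} (hlo : 0 < lo) (hhi : 0 ≤ hi) (hΛ : 1 ≤ Λ) (hβ : 0 ≤ β)
    {ν : ℝ} (hν : 0 < ν) (hν1 : ν ≤ 1) {n : ℕ} (hn : 0 < n) {𝔸 : Torus.Visc4 (Fin 3)}
    (hodd : Torus.OddSmall 𝔸 (ν * β)) (hiso : ∃ lam ∈ Set.Icc (1:ℝ) Λ, Torus.NearIso 𝔸 (ν * (lo / lam)) (ν * (hi * lam)))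
    (hoddΦ : Torus.OddSmall (Φ ν ((1 / ν) • 𝔸)) β)
    (hisoΦ : ∃ lam ∈ Set.Icc (1:ℝ) Λ, Torus.NearIso (Φ ν ((1 / ν) • 𝔸)) (lo / lam) (hi * lam))
    {Tw : ℝ} {U T : ℝ → ℝ → (V2 →L[ℝ] V2)}
    (hU : Torus.IsPropagator Tw (cellField W M hM ν hν n) ((1 / (n:ℝ) ^ 2) • 𝔸) U)
    (hT : Torus.IsPropagator Tw (fun (_ : ℝ) (_ : UnitAddTorus (Fin 3)) => (0 : EuclideanSpace ℝ (Fin 3)))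
      ((1 / (n:ℝ) ^ 2) • (𝔸 + (c / ν) • Φ ν ((1 / ν) • 𝔸))) T)
    {s t : ℝ} (hs : 0 ≤ s) (hst : s < t) (htT : t ≤ Tw) (hshort : t - s ≤ M * W.period / ν)
    (x ζ : V2) (hfast : IsFast n x ∨ IsFast n ζ) :
    |⟪U s t x - T s t x, ζ⟫_ℝ| ≤
      (2 * k * Λ / (c * lo) + 2 * k * Real.sqrt (M * W.period * Λ / (c * lo)) + (2 / c + 1) * Λ * (hi * Λ + β / 2) / lo + 16) *
        Real.sqrt (lossFwd (T s t) x) * Real.sqrt (lossAdj (T s t) ζ) := by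
  classical
  -- ### positivity bookkeeping
  have hn' : (0:ℝ) < n := by exact_mod_cast hn
  have hτ : 0 < t - s := sub_pos.2 hst
  have hc1 : (0:ℝ) ≤ 1 / (n:ℝ) ^ 2 := by positivity
  have hcν : 0 ≤ c / ν := by positivity
  obtain ⟨lam₁, ⟨hlam₁, hlam₁Λ⟩, h𝔸⟩ := hiso
  obtain ⟨lam₂, ⟨hlam₂, hlam₂Λ⟩, hΦ⟩ := hisoΦ
  have hlam₁0 : 0 < lam₁ := by linarith
  have hlam₂0 : 0 < lam₂ := by linarith
  have hΛ0 : 0 < Λ := by linarith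
  -- ### the two tensors
  have h𝔹₁ : Torus.NearIso ((1 / (n:ℝ) ^ 2) • 𝔸) (1 / (n:ℝ) ^ 2 * (ν * (lo / lam₁))) (1 / (n:ℝ) ^ 2 * (ν * (hi * lam₁))) := h𝔸.smul hc1
  have hlo₁ : 0 < 1 / (n:ℝ) ^ 2 * (ν * (lo / lam₁)) := by positivity
  have hhi₁ : 0 ≤ 1 / (n:ℝ) ^ 2 * (ν * (hi * lam₁)) := by positivity
  have hodd₁ : Torus.OddSmall ((1 / (n:ℝ) ^ 2) • 𝔸) (1 / (n:ℝ) ^ 2 * (ν * β)) := hodd.smul _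
  have hβ₁ : 0 ≤ 1 / (n:ℝ) ^ 2 * (ν * β) := by positivity
  have h𝔹₂ : Torus.NearIso ((1 / (n:ℝ) ^ 2) • (𝔸 + (c / ν) • Φ ν ((1 / ν) • 𝔸)))
      (1 / (n:ℝ) ^ 2 * (ν * (lo / lam₁) + c / ν * (lo / lam₂))) (1 / (n:ℝ) ^ 2 * (ν * (hi * lam₁) + c / ν * (hi * lam₂))) :=
    (h𝔸.add (hΦ.smul hcν)).smul hc1
  have hlo₂ : 0 < 1 / (n:ℝ) ^ 2 * (ν * (lo / lam₁) + c / ν * (lo / lam₂)) := by positivity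
  have hhi₂ : 0 ≤ 1 / (n:ℝ) ^ 2 * (ν * (hi * lam₁) + c / ν * (hi * lam₂)) := by positivity
  have hodd₂ : Torus.OddSmall ((1 / (n:ℝ) ^ 2) • (𝔸 + (c / ν) • Φ ν ((1 / ν) • 𝔸))) (1 / (n:ℝ) ^ 2 * (ν * β + c / ν * β)) :=
    (hodd.add (hoddΦ.smul _) (by positivity) (by positivity)).smul _
  have hβ₂ : 0 ≤ 1 / (n:ℝ) ^ 2 * (ν * β + c / ν * β) := by positivity
  -- the lower constant `lo⋆` of the coarse tensor
  have hloS : 0 < 1 / (n:ℝ) ^ 2 * (c / ν * (lo / Λ)) := by positivity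
  have hloS_le : 1 / (n:ℝ) ^ 2 * (c / ν * (lo / Λ)) ≤ 1 / (n:ℝ) ^ 2 * (ν * (lo / lam₁) + c / ν * (lo / lam₂)) := by
    refine mul_le_mul_of_nonneg_left ?_ hc1
    have h1 : lo / Λ ≤ lo / lam₂ := div_le_div_of_nonneg_left hlo.le hlam₂0 hlam₂Λ
    have h2 : 0 ≤ ν * (lo / lam₁) := by positivity
    nlinarith [mul_le_mul_of_nonneg_left h1 hcν]
  have h𝔹₂S := h𝔹₂.mono hloS_le le_rfl
  -- ### the carrier
  have hB0 : 0 ≤ (k : ℝ) / (2 * Real.pi * n) := by positivity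
  have hbB : ∀ τ y, ‖cellField W M hM ν hν n τ y‖ ≤ (k : ℝ) / (2 * Real.pi * n) := fun τ y => by
    unfold cellField; exact norm_cell_le_div _ hn τ y
  have hb : MemLp (Torus.stLift (cellField W M hM ν hν n)) ∞ (volume.restrict (Ioo 0 Tw ×ˢ (univ : Set (EuclideanSpace ℝ (Fin 3))))) :=
    memLp_top_stLift_cell _ n Tw
  have hbdiv : ∀ᵐ τ ∂(volume.restrict (Ioo (0:ℝ) Tw)), Torus.IsWeaklyDivFree (cellField W M hM ν hν n τ) :=
    ae_of_all _ fun τ => (isDivFree_cell _ n τ).isWeaklyDivFree_holds (isSmooth_cell _ n τ)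
  have hbB' : ∀ᵐ τ ∂(volume.restrict (Ioo (0:ℝ) Tw)), ∀ᵐ y ∂volume, ‖cellField W M hM ν hν n τ y‖ ≤ (k : ℝ) / (2 * Real.pi * n) :=
    ae_of_all _ fun τ => ae_of_all _ fun y => hbB τ y
  -- ### the auxiliary drift-free propagator `V` of the cell tensor
  have hz : MemLp (Torus.stLift (fun (_ : ℝ) (_ : UnitAddTorus (Fin 3)) => (0 : EuclideanSpace ℝ (Fin 3)))) ∞
      (volume.restrict (Ioo (0:ℝ) Tw ×ˢ (univ : Set (EuclideanSpace ℝ (Fin 3))))) := memLp_top_const 0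
  have hzdiv : ∀ᵐ τ ∂(volume.restrict (Ioo (0:ℝ) Tw)),
      Torus.IsWeaklyDivFree ((fun (_ : ℝ) (_ : UnitAddTorus (Fin 3)) => (0 : EuclideanSpace ℝ (Fin 3))) τ) :=
    ae_of_all _ fun τ θ hθ => by simp
  obtain ⟨V, hV⟩ := Torus.exists_isPropagator h𝔹₁ hlo₁ hz hzdiv
  -- ### the three analytic inputs
  have hA0 : 0 ≤ 3 * ((k : ℝ) / (2 * Real.pi * n)) * (t - s) := by positivity
  have hK0 : 0 ≤ 1 / (n:ℝ) ^ 2 * (ν * (hi * lam₁)) + 1 / (n:ℝ) ^ 2 * (ν * β) / 2 +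
      (1 / (n:ℝ) ^ 2 * (ν * (hi * lam₁) + c / ν * (hi * lam₂)) + 1 / (n:ℝ) ^ 2 * (ν * β + c / ν * β) / 2) := by positivity
  have hD0 : 0 ≤ 4 * Real.pi ^ 2 * (1 / (n:ℝ) ^ 2 * (ν * (hi * lam₁)) + 1 / (n:ℝ) ^ 2 * (ν * β) / 2 +
      (1 / (n:ℝ) ^ 2 * (ν * (hi * lam₁) + c / ν * (hi * lam₂)) + 1 / (n:ℝ) ^ 2 * (ν * β + c / ν * β) / 2)) * (t - s) := by positivity
  have hUV : ∀ y z : V2, Torus.IsWeaklyDivFree (z : VF) → Torus.eGradNormSq (z : VF) ≠ ⊤ →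
      |⟪U s t y, z⟫_ℝ - ⟪V s t y, z⟫_ℝ| ≤ 3 * ((k : ℝ) / (2 * Real.pi * n)) * (t - s) * ‖y‖ * Real.sqrt ((Torus.eGradNormSq (z : VF)).toReal) :=
    fun y z hz1 hz2 => abs_inner_sub_inner_driftFree_le h𝔹₁ hlo₁ hb hbdiv hB0 hbB' hU hV hs hst.le htT y z hz1 hz2
  have hUV' : ∀ y z : V2, Torus.IsWeaklyDivFree (y : VF) → Torus.eGradNormSq (y : VF) ≠ ⊤ →
      |⟪U s t y, z⟫_ℝ - ⟪V s t y, z⟫_ℝ| ≤ 3 * ((k : ℝ) / (2 * Real.pi * n)) * (t - s) * ‖z‖ * Real.sqrt ((Torus.eGradNormSq (y : VF)).toReal) :=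
    fun y z hy1 hy2 => abs_inner_sub_inner_driftFree_le_adjoint h𝔹₁ hlo₁ hb hbdiv hB0 hbB hU hV hs hst.le htT y z hy1 hy2
  have hVT : ∀ (y z : V2) (S : Finset (Fin 3 → ℤ)), Torus.IsWeaklyDivFree (y : VF) → Torus.IsWeaklyDivFree (z : VF) →
      (∀ k', k' ∉ S → fc z k' = 0) →
      |⟪V s t y, z⟫_ℝ - ⟪T s t y, z⟫_ℝ| ≤ 4 * Real.pi ^ 2 * (1 / (n:ℝ) ^ 2 * (ν * (hi * lam₁)) + 1 / (n:ℝ) ^ 2 * (ν * β) / 2 +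
        (1 / (n:ℝ) ^ 2 * (ν * (hi * lam₁) + c / ν * (hi * lam₂)) + 1 / (n:ℝ) ^ 2 * (ν * β + c / ν * β) / 2)) * (t - s) *
        ∑ k' ∈ S, Torus.freqNormSq k' * (‖fc y k'‖ * ‖fc z k'‖) :=
    fun y z S hy hz' hS => abs_inner_sub_inner_tensorChange_le h𝔹₁ hlo₁ hhi₁ hodd₁ hβ₁ h𝔹₂ hlo₂ hhi₂ hodd₂ hβ₂ hV hT hs hst.le htT y z hy hz' S hS
  -- ### the split level
  have hκτ0 : 0 < 8 * Real.pi ^ 2 * (1 / (n:ℝ) ^ 2 * (c / ν * (lo / Λ))) * (t - s) := by positivity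
  obtain ⟨N, hN1, hN2⟩ : ∃ N : ℕ, 8 * Real.pi ^ 2 * (1 / (n:ℝ) ^ 2 * (c / ν * (lo / Λ))) * (t - s) * (N : ℝ) ^ 2 ≤ 1 ∧
      1 ≤ 8 * Real.pi ^ 2 * (1 / (n:ℝ) ^ 2 * (c / ν * (lo / Λ))) * (t - s) * ((N : ℝ) + 1) ^ 2 := by
    obtain ⟨κτ, hκτ⟩ : ∃ κτ : ℝ, κτ = 8 * Real.pi ^ 2 * (1 / (n:ℝ) ^ 2 * (c / ν * (lo / Λ))) * (t - s) := ⟨_, rfl⟩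
    rw [← hκτ] at hκτ0 ⊢
    refine ⟨Nat.floor (1 / Real.sqrt κτ), ?_, ?_⟩
    · have h1 : ((Nat.floor (1 / Real.sqrt κτ) : ℕ) : ℝ) ≤ 1 / Real.sqrt κτ := Nat.floor_le (by positivity)
      have h2 : ((Nat.floor (1 / Real.sqrt κτ) : ℕ) : ℝ) ^ 2 ≤ (1 / Real.sqrt κτ) ^ 2 := pow_le_pow_left₀ (Nat.cast_nonneg _) h1 2
      rw [div_pow, one_pow, Real.sq_sqrt hκτ0.le] at h2
      calc κτ * ((Nat.floor (1 / Real.sqrt κτ) : ℕ) : ℝ) ^ 2 ≤ κτ * (1 / κτ) := mul_le_mul_of_nonneg_left h2 hκτ0.le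
        _ = 1 := by field_simp
    · have h1 : 1 / Real.sqrt κτ < ((Nat.floor (1 / Real.sqrt κτ) : ℕ) : ℝ) + 1 := Nat.lt_floor_add_one _
      have h2 : (1 / Real.sqrt κτ) ^ 2 ≤ (((Nat.floor (1 / Real.sqrt κτ) : ℕ) : ℝ) + 1) ^ 2 := pow_le_pow_left₀ (by positivity) h1.le 2
      rw [div_pow, one_pow, Real.sq_sqrt hκτ0.le] at h2
      calc (1:ℝ) = κτ * (1 / κτ) := by field_simp
        _ ≤ κτ * (((Nat.floor (1 / Real.sqrt κτ) : ℕ) : ℝ) + 1) ^ 2 := mul_le_mul_of_nonneg_left h2 hκτ0.le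
  -- ### Leray reduction
  have hxP : Torus.IsWeaklyDivFree (((Torus.divFreeL2 (Fin 3)).starProjection x : V2) : VF) := Torus.isWeaklyDivFree_starProjection x
  have hζP : Torus.IsWeaklyDivFree (((Torus.divFreeL2 (Fin 3)).starProjection ζ : V2) : VF) := Torus.isWeaklyDivFree_starProjection ζ
  have hfastP : IsFast n ((Torus.divFreeL2 (Fin 3)).starProjection x) ∨ IsFast n ((Torus.divFreeL2 (Fin 3)).starProjection ζ) := by
    have key : ∀ y : V2, IsFast n y → IsFast n ((Torus.divFreeL2 (Fin 3)).starProjection y) := fun y hy k' hk' => by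
      have h := Torus.norm_mFourierCoeff_starProjection_le y k'
      have h0 : ‖fc ((Torus.divFreeL2 (Fin 3)).starProjection y) k'‖ ≤ 0 := by
        calc ‖fc ((Torus.divFreeL2 (Fin 3)).starProjection y) k'‖ ≤ ‖fc y k'‖ := h
          _ = 0 := by rw [hy k' hk', norm_zero]
      exact norm_le_zero_iff.1 h0
    rcases hfast with h | h
    · exact Or.inl (key x h)
    · exact Or.inr (key ζ h)
  have hpair := Z7Glue.pairing_eq_pairing_starProjection hT hU s t x ζ
  have hqP : lossFwd (T s t) ((Torus.divFreeL2 (Fin 3)).starProjection x) ≤ lossFwd (T s t) x := Z7Glue.lossFwd_starProjection_le hT s t x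
  have hpP : lossAdj (T s t) ((Torus.divFreeL2 (Fin 3)).starProjection ζ) ≤ lossAdj (T s t) ζ := Z7Glue.lossAdj_starProjection_le hT s t ζ
  -- ### the core
  have hcore := short_window_core h𝔹₁ hlo₁ h𝔹₂S hloS hV hT (U s t) (hU.norm_le s t) hs hst htT hA0 hD0 hUV hUV' hVT N hN1 hN2
    _ _ hxP hζP hfastP
  rw [hpair]
  refine hcore.trans ?_
  have hSq : Real.sqrt (lossFwd (T s t) ((Torus.divFreeL2 (Fin 3)).starProjection x)) *
        Real.sqrt (lossAdj (T s t) ((Torus.divFreeL2 (Fin 3)).starProjection ζ)) ≤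
      Real.sqrt (lossFwd (T s t) x) * Real.sqrt (lossAdj (T s t) ζ) :=
    mul_le_mul (Real.sqrt_le_sqrt hqP) (Real.sqrt_le_sqrt hpP) (Real.sqrt_nonneg _) (Real.sqrt_nonneg _)
  -- ### the constant
  have hT1 := shortConst_term1_le k n hn hc hlo hΛ0 hν hν1 hτ (by positivity : (0:ℝ) < (((n / 4 : ℕ) : ℝ)) ^ 2 + 1) (div_sixteen_le_sqrt_m n)
  have hT2 := shortConst_term2_le k n hn (P₀ := M * W.period) hc hlo hΛ0 hν hτ hshort
  have hT3 := shortConst_term3_le n hn (τ := t - s) hc hlo hhi hβ hν hν1 hτ hlam₁ hlam₁Λ hlam₂Λ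
  have hC : 4 * Real.pi * (3 * ((k : ℝ) / (2 * Real.pi * n)) * (t - s)) /
          (8 * Real.pi ^ 2 * (1 / (n:ℝ) ^ 2 * (c / ν * (lo / Λ))) * (t - s) * Real.sqrt ((((n / 4 : ℕ) : ℝ)) ^ 2 + 1)) +
        8 * Real.sqrt 2 * Real.pi * (3 * ((k : ℝ) / (2 * Real.pi * n)) * (t - s)) /
          Real.sqrt (8 * Real.pi ^ 2 * (1 / (n:ℝ) ^ 2 * (c / ν * (lo / Λ))) * (t - s)) +
        2 * (4 * Real.pi ^ 2 * (1 / (n:ℝ) ^ 2 * (ν * (hi * lam₁)) + 1 / (n:ℝ) ^ 2 * (ν * β) / 2 +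
          (1 / (n:ℝ) ^ 2 * (ν * (hi * lam₁) + c / ν * (hi * lam₂)) + 1 / (n:ℝ) ^ 2 * (ν * β + c / ν * β) / 2)) * (t - s)) /
          (8 * Real.pi ^ 2 * (1 / (n:ℝ) ^ 2 * (c / ν * (lo / Λ))) * (t - s)) + 16 ≤
      2 * k * Λ / (c * lo) + 2 * k * Real.sqrt (M * W.period * Λ / (c * lo)) + (2 / c + 1) * Λ * (hi * Λ + β / 2) / lo + 16 := by
    linarith [hT1, hT2, hT3]
  have hCs0 : 0 ≤ 4 * Real.pi * (3 * ((k : ℝ) / (2 * Real.pi * n)) * (t - s)) /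
          (8 * Real.pi ^ 2 * (1 / (n:ℝ) ^ 2 * (c / ν * (lo / Λ))) * (t - s) * Real.sqrt ((((n / 4 : ℕ) : ℝ)) ^ 2 + 1)) +
        8 * Real.sqrt 2 * Real.pi * (3 * ((k : ℝ) / (2 * Real.pi * n)) * (t - s)) /
          Real.sqrt (8 * Real.pi ^ 2 * (1 / (n:ℝ) ^ 2 * (c / ν * (lo / Λ))) * (t - s)) +
        2 * (4 * Real.pi ^ 2 * (1 / (n:ℝ) ^ 2 * (ν * (hi * lam₁)) + 1 / (n:ℝ) ^ 2 * (ν * β) / 2 +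
          (1 / (n:ℝ) ^ 2 * (ν * (hi * lam₁) + c / ν * (hi * lam₂)) + 1 / (n:ℝ) ^ 2 * (ν * β + c / ν * β) / 2)) * (t - s)) /
          (8 * Real.pi ^ 2 * (1 / (n:ℝ) ^ 2 * (c / ν * (lo / Λ))) * (t - s)) + 16 := by positivity
  have hfin := mul_le_mul hC hSq (by positivity) (hCs0.trans hC)
  simpa only [mul_assoc] using hfin

end Summit.AnomalousDissipation.AnomalousDissipation.Theorems.SolenoidalFractalHomogenisation.LagrangianStep.VmodFlat

end
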